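import Literature.NumberTheory.ModularSymbols.FullLevelHomologyHeckeTransfer
import HarnessLib

/-!
# The up/down dictionary on a finite sum of coset symbols `Σᵢ [gᵢ] ⊗ cᵢ δ_{yᵢ}`:
# `cosetClass ↦ Σᵢ cᵢ · {∞, (δ⁻¹ t_s(gᵢ, yᵢ) δ)∞}` for ANY normalised section `s`

Topic `Literature/NumberTheory/ModularSymbols`; namespace `Literature.NumberTheory.ModularSymbols.FullLevel`; sequel of
`FullLevelHomologyCosetClasses` (`cosetClass`, `torusInvariantsEquiv_cosetClass_of_eq`, `torusLevelH1Iso_single`) and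
`FullLevelHomologyHeckeTransfer` (`baseCoset`; the special case of the Hecke family with the section `sec`).
Definitions with bodies + proved theorems; no named fact, no `sorry`, no instance, no notation.

This file isolates, once and for all, the bookkeeping used by `FullLevelHomologyHeckeTransfer` (where the index set is
the Hecke cosets and the section is the chosen `sec`): for a finite family `(gᵢ, yᵢ, cᵢ)` of elements `gᵢ ∈ Γ₀(M)`,
cosets `yᵢ ∈ GL₂(ℤ/p)/T̃` and coefficients `cᵢ ∈ k` whose chain `C = Σᵢ [gᵢ] ⊗ cᵢδ_{yᵢ}` is a `1`-cycle, and for ANY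
section `s : GL₂(ℤ/p)/T̃ → Γ₀(M)` of the transitive action (`s(y)·T̃ = y`), the explicit degree-one transfer of
`GroupHomologyPermutationModuleGenerators` gives `[C] = componentMap [Σᵢ t_s(gᵢ, yᵢ) ⊗ cᵢ]` with
`t_s(g, y) = s(y)⁻¹ g s(ḡ⁻¹y) ∈ Γ_T`, hence under the dictionary `H₁(…)^{T̃} ≃ H₁(Γ_T, k) ≃ H₁(Γ₀(p²M), k) ↠ H(p²M; k)`:

* `familyChain`, `transferFamily s i = t_s(gᵢ, yᵢ)`, `transferFamily_mem` (`∈ Γ_T`), `transferFamilyChain`,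
  `symbolPart_familyChain`, `componentMap_transferFamilyChain`;
* **`torusInvariantsToCuspidal_cosetClass_family`**:
  `torusInvariantsToCuspidal (cosetClass ⟨C, hC⟩) = Σᵢ cᵢ · ({∞, (δ⁻¹ t_s(gᵢ, yᵢ) δ)∞} ⊗ 1)`.

The freedom in `s` is what the sequels use: for the twisting operator the cosets are `u(w)T̃` and the convenient section
is `w ↦ (1 w̃; 0 1)` (then `δ⁻¹ t δ = (1 −w̃/p; 0 1) γ' (1 w̃'/p; 0 1)` has cusp `γ'∞ − w̃/p`); for the kernel analysis
of the spread period map any section does.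

## References
* K. S. Brown, *Cohomology of Groups* (1982), Ch. III §6 Prop. 6.2, §9 (A)–(B) (transfer). [Brown1982]
* A. Ash, G. Stevens, Duke Math. J. 53 (1986), §1 (1.2)–(1.4). [AshStevens1986]
* A. W. Knapp, *Elliptic Curves* (1993), Prop. 11.22. [Knapp1993]
-/

noncomputable section

namespace Literature.NumberTheory.ModularSymbols

namespace FullLevel

open scoped MatrixGroups TensorProduct
open CategoryTheory CongruenceSubgroup groupHomology Finsupp Matrix
open Literature.Algebra.Homology
open Literature.NumberTheory.EllipticCurves.ModularForms

variable (k : Type) [CommRing k] (p M : ℕ) [Fact p.Prime]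
variable (s : GL (Fin 2) (ZMod p) ⧸ diagTorus (ZMod p) → Gamma0 M) (hs : ∀ y, redGL p M (s y) • baseCoset p = y)

/-! ### A finite family of coset symbols and its transfer to `Γ_T` -/

/-- The chain `C = Σᵢ [gᵢ] ⊗ cᵢ δ_{yᵢ}` with coefficients in `k[GL₂(ℤ/p)/T̃]`. [cite: Brown1982, Ch. III §9 (A)] -/
def familyChain {ι : Type} [Fintype ι] (g : ι → Gamma0 M) (y : ι → GL (Fin 2) (ZMod p) ⧸ diagTorus (ZMod p))
    (c : ι → k) : Gamma0 M →₀ PermutationCoeff.permRepObj k (redGL p M) (GL (Fin 2) (ZMod p) ⧸ diagTorus (ZMod p)) :=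
  ∑ i, single (g i) (single (y i) (c i))

include hs in
/-- The transfer element `t_s(g, y) = s(y)⁻¹ g s(ḡ⁻¹ y)` lies in `Γ_T` (any section `s`). [cite: Brown1982, Ch. III §9 (A)] -/
theorem transferElt_mem_torusLevel (g : Gamma0 M) (y : GL (Fin 2) (ZMod p) ⧸ diagTorus (ZMod p)) :
    PermutationCoeff.transferElt (redGL p M) s g y ∈ torusLevel p M :=
  PermutationCoeff.transferElt_mem (redGL p M) (fun _ => baseCoset p) s hs (fun _ _ => rfl) g y

/-- The transfer elements `tᵢ = t_s(gᵢ, yᵢ) ∈ Γ_T` of the family. [cite: Brown1982, Ch. III §9 (A)] -/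
def transferFamily {ι : Type} (g : ι → Gamma0 M) (y : ι → GL (Fin 2) (ZMod p) ⧸ diagTorus (ZMod p)) (i : ι) :
    torusLevel p M :=
  ⟨PermutationCoeff.transferElt (redGL p M) s (g i) (y i), transferElt_mem_torusLevel p M s hs (g i) (y i)⟩

/-- Unfolding `transferFamily`. [cite: Brown1982, Ch. III §9 (A)] -/
theorem coe_transferFamily {ι : Type} (g : ι → Gamma0 M) (y : ι → GL (Fin 2) (ZMod p) ⧸ diagTorus (ZMod p)) (i : ι) :
    (transferFamily p M s hs g y i : Gamma0 M) = (s (y i))⁻¹ * g i * s ((redGL p M (g i))⁻¹ • y i) := by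
  show PermutationCoeff.transferElt (redGL p M) s (g i) (y i) = _
  rw [PermutationCoeff.transferElt, map_inv]

/-- The transferred chain `Σᵢ [tᵢ] ⊗ cᵢ ∈ C₁(Γ_T, k)`. [cite: Brown1982, Ch. III §9 (A)] -/
def transferFamilyChain {ι : Type} [Fintype ι] (g : ι → Gamma0 M) (y : ι → GL (Fin 2) (ZMod p) ⧸ diagTorus (ZMod p))
    (c : ι → k) : torusLevel p M →₀ k :=
  ∑ i, single (transferFamily p M s hs g y i) (c i)

/-- `symbolPart_s(C) = Σᵢ [tᵢ] ⊗ cᵢ δ_{T̃}`. [cite: Brown1982, Ch. III §9 (A)] -/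
theorem symbolPart_familyChain {ι : Type} [Fintype ι] (g : ι → Gamma0 M)
    (y : ι → GL (Fin 2) (ZMod p) ⧸ diagTorus (ZMod p)) (c : ι → k) :
    PermutationCoeff.symbolPart (redGL p M) (fun _ => baseCoset p) s (familyChain k p M g y c) =
      ∑ i, single ((transferFamily p M s hs g y i : Gamma0 M)) (single (baseCoset p) (c i)) := by
  rw [familyChain, map_sum]
  refine Finset.sum_congr rfl fun i _ => ?_
  rw [PermutationCoeff.symbolPart_single_single]
  rfl

/-- The chain of `componentMap [Σᵢ tᵢ ⊗ cᵢ]` is `Σᵢ [tᵢ] ⊗ cᵢ δ_{T̃}`. [cite: Brown1982, Ch. III §6 (6.3)] -/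
theorem coe_mapCycles₁_transferFamilyChain {ι : Type} [Fintype ι] (g : ι → Gamma0 M)
    (y : ι → GL (Fin 2) (ZMod p) ⧸ diagTorus (ZMod p)) (c : ι → k) :
    (mapCycles₁ (A := Rep.trivial k (torusLevel p M) k)
        (B := PermutationCoeff.permRepObj k (redGL p M) (GL (Fin 2) (ZMod p) ⧸ diagTorus (ZMod p)))
        (torusLevel p M).subtype (PermutationCoeff.toPermHom k (redGL p M) (baseCoset p))
        ((cycles₁IsoOfIsTrivial (Rep.trivial k (torusLevel p M) k)).inv (transferFamilyChain k p M s hs g y c))).1 =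
      ∑ i, single ((transferFamily p M s hs g y i : Gamma0 M)) (single (baseCoset p) (c i)) := by
  rw [coe_mapCycles₁, cycles₁IsoOfIsTrivial_inv_apply, transferFamilyChain, map_sum]
  refine Finset.sum_congr rfl fun i _ => ?_
  simp only [ModuleCat.hom_ofHom, LinearMap.coe_comp, Function.comp_apply, lmapDomain_apply,
    mapDomain_single, mapRange.linearMap_apply, mapRange_single, Subgroup.coe_subtype]
  rfl

/-- **The family cycle transfers to `Σᵢ [tᵢ] ⊗ cᵢ`**: `componentMap [Σᵢ tᵢ ⊗ cᵢ] = [C]` whenever `C` is a cycle.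
[cite: Brown1982, Ch. III §9 (A)–(B)] -/
theorem componentMap_transferFamilyChain {ι : Type} [Fintype ι] (g : ι → Gamma0 M)
    (y : ι → GL (Fin 2) (ZMod p) ⧸ diagTorus (ZMod p)) (c : ι → k)
    (hC : familyChain k p M g y c ∈
      cycles₁ (PermutationCoeff.permRepObj k (redGL p M) (GL (Fin 2) (ZMod p) ⧸ diagTorus (ZMod p)))) :
    PermutationCoeff.componentMap k (redGL p M) (baseCoset p)
        (H1π (Rep.trivial k (torusLevel p M) k)
          ((cycles₁IsoOfIsTrivial (Rep.trivial k (torusLevel p M) k)).inv (transferFamilyChain k p M s hs g y c))) =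
      H1π _ ⟨familyChain k p M g y c, hC⟩ := by
  change (groupHomology.map (A := Rep.trivial k (torusLevel p M) k)
      (B := PermutationCoeff.permRepObj k (redGL p M) (GL (Fin 2) (ZMod p) ⧸ diagTorus (ZMod p)))
      (torusLevel p M).subtype (PermutationCoeff.toPermHom k (redGL p M) (baseCoset p)) 1)
      (H1π (Rep.trivial k (torusLevel p M) k)
        ((cycles₁IsoOfIsTrivial (Rep.trivial k (torusLevel p M) k)).inv (transferFamilyChain k p M s hs g y c))) = _
  rw [groupHomology.H1π_comp_map_apply (A := Rep.trivial k (torusLevel p M) k)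
      (B := PermutationCoeff.permRepObj k (redGL p M) (GL (Fin 2) (ZMod p) ⧸ diagTorus (ZMod p))),
    PermutationCoeff.H1π_eq_H1π_symbolPart (redGL p M) (fun _ => baseCoset p) s hs (fun _ _ => rfl)
      ⟨familyChain k p M g y c, hC⟩]
  congr 1
  apply Subtype.ext
  exact (coe_mapCycles₁_transferFamilyChain k p M s hs g y c).trans (symbolPart_familyChain k p M s hs g y c).symm

variable (hpM : Nat.Coprime p M) [Fintype (diagTorus (ZMod p))] [Invertible (Fintype.card (diagTorus (ZMod p)) : k)]

/-- **The dictionary on a family of coset symbols**: for ANY normalised section `s`,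
`torusInvariantsToCuspidal (cosetClass [Σᵢ [gᵢ] ⊗ cᵢδ_{yᵢ}]) = Σᵢ cᵢ · ({∞, (δ⁻¹ t_s(gᵢ,yᵢ) δ)∞} ⊗ 1) ∈ H(p²M; k)`.
[cite: AshStevens1986, §1 (1.3)–(1.4); Knapp1993, Prop. 11.22] -/
theorem torusInvariantsToCuspidal_cosetClass_family [NeZero M] [NeZero (p ^ 2 * M)] {ι : Type} [Fintype ι]
    (g : ι → Gamma0 M) (y : ι → GL (Fin 2) (ZMod p) ⧸ diagTorus (ZMod p)) (c : ι → k)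
    (hC : familyChain k p M g y c ∈
      cycles₁ (PermutationCoeff.permRepObj k (redGL p M) (GL (Fin 2) (ZMod p) ⧸ diagTorus (ZMod p)))) :
    torusInvariantsToCuspidal k p M hpM (cosetClass k p M ⟨familyChain k p M g y c, hC⟩) =
      ∑ i, c i • Literature.NumberTheory.ModularSymbols.symbol (p ^ 2 * M) k
        (torusLevelEquiv p M hpM (transferFamily p M s hs g y i) : Gamma0 (p ^ 2 * M)) := by
  rw [torusInvariantsToCuspidal, LinearMap.comp_apply, LinearEquiv.coe_coe, torusInvariantsEquivGamma0,
    LinearEquiv.trans_apply,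
    torusInvariantsEquiv_cosetClass_of_eq k p M hpM _ _ (componentMap_transferFamilyChain k p M s hs g y c hC),
    Iso.toLinearEquiv_apply, transferFamilyChain, map_sum, map_sum, map_sum, map_sum]
  refine Finset.sum_congr rfl fun i _ => ?_
  rw [torusLevelH1Iso_single]
  exact cuspidalClassMap_single (p ^ 2 * M) k _ (c i)

end FullLevel

end Literature.NumberTheory.ModularSymbols
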